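import Mathlib
import HarnessLib
import Summits.ValiantsHypothesis.ValiantsHypothesis.Theorems.LacunarySymmetroidMatrixDescartesProductPlusOneRowLawsK

/-!
# LINE (A) `product_plus_one` (crux `MatrixDescartes`, stmt-ValiantsHypothesis-18050, V1) — W-CB: the rate-free slow-knee cell for EVERY K, FULL BINOMIAL MENU
# (binomials on EVERY pair of letters: knees of rate ≤ p, poles of rate ≥ p) — the every-K theorem that contains ✓ `slowKneeCellRateFree_…` (K = 3) entirely

Owner memo §19–§24 (W-CB, `K^> = 0`).  Support `d : Fin (n+2) → ℕ`, `StrictMono d`, base rate `p = d 1 − d 0`, window `(u,v)`, `0 < u`; MENU per row: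
(B) binomial on `(d₀, d_{l₀+1})` — any signs on the slow pair, POLE otherwise — root outside `(u,v)`; (P) binomial on a pair `(d_{i+1}, d_{j+1})` of non-bottom
letters (`i < j`): POLE (`a_i a_j < 0`) when `d_{j+1} − d_{i+1} ≥ p` with root outside `(u,v)`, KNEE (`a_i a_j > 0`) when `d_{j+1} − d_{i+1} ≤ p`; (C) unswitched
incoherent K-nomial.  Then `W(∏_j f_j)` has ≤ 2 roots in `(u,v)` and `eulerNumerator d a l₀` ≤ 3, every coupling.  Proof: ✓ `wronskianK_roots_le_two_of_rowLaws` fed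
with ✓ `rowLaws_single` / ✓ `rowLaws_pair` / ✓ `rowLaws_cloud`.

* ★★ `slowKneeCellEveryKPairs_wronskian_roots_le_two`, `slowKneeCellEveryKPairs_eval_ne_zero`, ★★ `slowKneeCellEveryKPairs_eulerNumerator_roots_le_three`.

At K = 3 (n = 1) the menu is exactly ✓ p703728's (E4⁺) — this file GENERALISES it to every K (no re-proof of the K = 3 statement).  Honest framing: ONE W-cell
family (helper); fast-knee cells, `WronskianBudgetK3`, `OneChangeFloorK3`, `stub_classRowK3`, `stub_polyLaw`, `MatrixDescartes`, B NOT proved; `VP ≠ VNP` NOT proved.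
No definitions, no named facts.
-/

set_option linter.dupNamespace false

namespace Summit.ValiantsHypothesis.ValiantsHypothesis.Theorems.LacunarySymmetroidMatrixDescartes

namespace ProductPlusOne

open Finset Set Polynomial
open scoped BigOperators Topology Polynomial

/-- ★★ **THE RATE-FREE SLOW-KNEE CELL FOR EVERY K, FULL BINOMIAL MENU**: `W(∏_j f_j)` has AT MOST TWO roots in `(u,v)`. [this file's theorem] -/
theorem slowKneeCellEveryKPairs_wronskian_roots_le_two {m n : ℕ} (d : Fin (n + 2) → ℕ) (hd : StrictMono d)
    (a : Fin m → Fin (n + 2) → ℝ) {u v : ℝ} (hu : 0 < u)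
    (hrow : ∀ j,
      (∃ l₀ : Fin (n + 1), (∀ l, l ≠ l₀ → a j l.succ = 0) ∧ a j 0 ≠ 0 ∧ a j l₀.succ ≠ 0 ∧ (l₀ = 0 ∨ a j 0 * a j l₀.succ < 0) ∧
          0 ≤ (∑ l, C (a j l) * X ^ (d l) : ℝ[X]).eval u * (∑ l, C (a j l) * X ^ (d l) : ℝ[X]).eval v) ∨
      (∃ i i' : Fin (n + 1), i < i' ∧ a j 0 = 0 ∧ (∀ l, l ≠ i → l ≠ i' → a j l.succ = 0) ∧ a j i'.succ ≠ 0 ∧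
          ((a j i.succ * a j i'.succ < 0 ∧ d 1 - d 0 ≤ d i'.succ - d i.succ ∧
              0 ≤ (∑ l, C (a j l) * X ^ (d l) : ℝ[X]).eval u * (∑ l, C (a j l) * X ^ (d l) : ℝ[X]).eval v) ∨
            (0 < a j i.succ * a j i'.succ ∧ d i'.succ - d i.succ ≤ d 1 - d 0))) ∨
      (0 < a j 0 ∧ (∀ l : Fin (n + 1), a j l.succ ≤ 0) ∧ ∑ l : Fin (n + 1), a j l.succ < 0 ∧
          0 < (∑ l, C (a j l) * X ^ (d l) : ℝ[X]).eval v)) :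
    (((∏ j, ∑ l, C (a j l) * X ^ (d l) : ℝ[X]) * (X * derivative (X * derivative (∏ j, ∑ l, C (a j l) * X ^ (d l) : ℝ[X])))
        - (X * derivative (∏ j, ∑ l, C (a j l) * X ^ (d l) : ℝ[X])) ^ 2).roots.toFinset.filter (fun t => u < t ∧ t < v)).card ≤ 2 := by
  refine wronskianK_roots_le_two_of_rowLaws d hd a hu fun j x hx => ?_
  rcases hrow j with ⟨l₀, hzero, h0, hl0, hkind, hend⟩ | ⟨i, i', hii', h00, hzero, hi', hkind⟩ | ⟨_, hle, hsum, hvpos⟩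
  · exact rowLaws_single d hd (a j) hu l₀ hzero h0 hl0 hkind hend hx
  · exact rowLaws_pair d hd (a j) hu i i' hii' h00 hzero hi' hkind hx
  · exact rowLaws_cloud d hd (a j) hu hle hsum hvpos hx

/-- No menu row vanishes on the window (every K, full menu). [this file's lemma] -/
theorem slowKneeCellEveryKPairs_eval_ne_zero {m n : ℕ} (d : Fin (n + 2) → ℕ) (hd : StrictMono d)
    (a : Fin m → Fin (n + 2) → ℝ) {u v : ℝ} (hu : 0 < u)
    (hrow : ∀ j,
      (∃ l₀ : Fin (n + 1), (∀ l, l ≠ l₀ → a j l.succ = 0) ∧ a j 0 ≠ 0 ∧ a j l₀.succ ≠ 0 ∧ (l₀ = 0 ∨ a j 0 * a j l₀.succ < 0) ∧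
          0 ≤ (∑ l, C (a j l) * X ^ (d l) : ℝ[X]).eval u * (∑ l, C (a j l) * X ^ (d l) : ℝ[X]).eval v) ∨
      (∃ i i' : Fin (n + 1), i < i' ∧ a j 0 = 0 ∧ (∀ l, l ≠ i → l ≠ i' → a j l.succ = 0) ∧ a j i'.succ ≠ 0 ∧
          ((a j i.succ * a j i'.succ < 0 ∧ d 1 - d 0 ≤ d i'.succ - d i.succ ∧
              0 ≤ (∑ l, C (a j l) * X ^ (d l) : ℝ[X]).eval u * (∑ l, C (a j l) * X ^ (d l) : ℝ[X]).eval v) ∨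
            (0 < a j i.succ * a j i'.succ ∧ d i'.succ - d i.succ ≤ d 1 - d 0))) ∨
      (0 < a j 0 ∧ (∀ l : Fin (n + 1), a j l.succ ≤ 0) ∧ ∑ l : Fin (n + 1), a j l.succ < 0 ∧
          0 < (∑ l, C (a j l) * X ^ (d l) : ℝ[X]).eval v))
    {x : ℝ} (hx : x ∈ Ioo u v) (j : Fin m) : (∑ l, C (a j l) * X ^ (d l) : ℝ[X]).eval x ≠ 0 := by
  have hd0 : ∀ l, d 0 ≤ d l := fun l => hd.monotone (Fin.zero_le l)
  have hx0 : 0 < x := hu.trans hx.1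
  have hrl : a j 0 - ∑ l : Fin (n + 1), (-(a j l.succ)) * x ^ (d l.succ - d 0) ≠ 0 := by
    rcases hrow j with ⟨l₀, hzero, h0, hl0, hkind, hend⟩ | ⟨i, i', hii', h00, hzero, hi', hkind⟩ | ⟨_, hle, hsum, hvpos⟩
    · exact (rowLaws_single d hd (a j) hu l₀ hzero h0 hl0 hkind hend hx).1
    · exact (rowLaws_pair d hd (a j) hu i i' hii' h00 hzero hi' hkind hx).1
    · exact (rowLaws_cloud d hd (a j) hu hle hsum hvpos hx).1
  rw [eval_rowK_eq d hd0 (a j) x]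
  exact mul_ne_zero (pow_ne_zero _ hx0.ne') hrl

/-- ★★ **THE EVERY-K FULL-MENU CELL IN THE FLOOR'S CURRENCY**: for every coupling `l₀`, `eulerNumerator d a l₀` (unfolded) has AT MOST THREE zeros in `(u,v)`.
[this file's theorem] -/
theorem slowKneeCellEveryKPairs_eulerNumerator_roots_le_three {m n : ℕ} (d : Fin (n + 2) → ℕ) (hd : StrictMono d)
    (a : Fin m → Fin (n + 2) → ℝ) (l₀ : Fin (n + 2)) {u v : ℝ} (hu : 0 < u)
    (hrow : ∀ j,
      (∃ l₀ : Fin (n + 1), (∀ l, l ≠ l₀ → a j l.succ = 0) ∧ a j 0 ≠ 0 ∧ a j l₀.succ ≠ 0 ∧ (l₀ = 0 ∨ a j 0 * a j l₀.succ < 0) ∧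
          0 ≤ (∑ l, C (a j l) * X ^ (d l) : ℝ[X]).eval u * (∑ l, C (a j l) * X ^ (d l) : ℝ[X]).eval v) ∨
      (∃ i i' : Fin (n + 1), i < i' ∧ a j 0 = 0 ∧ (∀ l, l ≠ i → l ≠ i' → a j l.succ = 0) ∧ a j i'.succ ≠ 0 ∧
          ((a j i.succ * a j i'.succ < 0 ∧ d 1 - d 0 ≤ d i'.succ - d i.succ ∧
              0 ≤ (∑ l, C (a j l) * X ^ (d l) : ℝ[X]).eval u * (∑ l, C (a j l) * X ^ (d l) : ℝ[X]).eval v) ∨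
            (0 < a j i.succ * a j i'.succ ∧ d i'.succ - d i.succ ≤ d 1 - d 0))) ∨
      (0 < a j 0 ∧ (∀ l : Fin (n + 1), a j l.succ ≤ 0) ∧ ∑ l : Fin (n + 1), a j l.succ < 0 ∧
          0 < (∑ l, C (a j l) * X ^ (d l) : ℝ[X]).eval v)) :
    ((∑ j, (∑ l, C (a j l * ((d l : ℝ) - d l₀)) * X ^ (d l)) * ∏ i ∈ Finset.univ.erase j, (∑ l, C (a i l) * X ^ (d l))
        : ℝ[X]).roots.toFinset.filter (fun t => u < t ∧ t < v)).card ≤ 3 := by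
  classical
  refine roots_Ioo_card_le_of_Icc _ 3 fun u' v' hu' hv' => ?_
  rcases lt_or_ge v' u' with hvu | huv'
  · have : ((∑ j, (∑ l, C (a j l * ((d l : ℝ) - d l₀)) * X ^ (d l)) * ∏ i ∈ Finset.univ.erase j, (∑ l, C (a i l) * X ^ (d l))
        : ℝ[X]).roots.toFinset.filter (fun t => u' ≤ t ∧ t ≤ v')) = ∅ :=
      Finset.filter_eq_empty_iff.2 fun t _ h => by linarith [h.1, h.2]
    rw [this]; simp
  have hu'0 : 0 < u' := hu.trans hu'
  have hP : ∀ t ∈ Set.Icc u' v', (∏ j, (∑ l, C (a j l) * X ^ (d l) : ℝ[X])).eval t ≠ 0 := by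
    intro t ht
    rw [eval_prod]
    exact Finset.prod_ne_zero_iff.2 fun j _ =>
      slowKneeCellEveryKPairs_eval_ne_zero d hd a hu hrow ⟨hu'.trans_le ht.1, ht.2.trans_lt hv'⟩ j
  have h1 := eulerNumerator_roots_Icc_le_wronskian_roots_add_one d a l₀ hu'0 hP
  have h2 := slowKneeCellEveryKPairs_wronskian_roots_le_two d hd a hu hrow
  have h3 : (((∏ j, ∑ l, C (a j l) * X ^ (d l) : ℝ[X]) * (X * derivative (X * derivative (∏ j, ∑ l, C (a j l) * X ^ (d l) : ℝ[X])))
            - (X * derivative (∏ j, ∑ l, C (a j l) * X ^ (d l) : ℝ[X])) ^ 2).roots.toFinset.filter (fun w => u' < w ∧ w < v')).card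
      ≤ (((∏ j, ∑ l, C (a j l) * X ^ (d l) : ℝ[X]) * (X * derivative (X * derivative (∏ j, ∑ l, C (a j l) * X ^ (d l) : ℝ[X])))
            - (X * derivative (∏ j, ∑ l, C (a j l) * X ^ (d l) : ℝ[X])) ^ 2).roots.toFinset.filter (fun t => u < t ∧ t < v)).card := by
    refine Finset.card_le_card fun t ht => ?_
    have ht' := Finset.mem_filter.1 ht
    exact Finset.mem_filter.2 ⟨ht'.1, hu'.trans ht'.2.1, ht'.2.2.trans hv'⟩
  omega

end ProductPlusOne

end Summit.ValiantsHypothesis.ValiantsHypothesis.Theorems.LacunarySymmetroidMatrixDescartes
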